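/-
COR-CM (cell pub-hodgecm2, stage 2 of the Hodge ladder) — count-neutral KERNEL COMBINATORICS «the octic product column G = Q₈ × B, D₄ × B: the type-stabiliser subgroup, β against φ₂, THE FLOOR»
(seat prover-pub-hodgecm2-b23-g45-0, binder prover b23, gen 45; own census lane OCTIC-PRODUCT, claim HOME/INBOX.md l.18829).  Theorems only — gen 44ʼs `Census/QuarticInversionStabiliser.lean` ported to the octic product datum (`y` central on `ι(H₀)`: the squares in the outer cosets pick up `ι(2a)`), on lit-andre-3ʼs `TypeStabiliser*` and b09ʼs `CoinvariantFloor` BY NAME; no `decide` beyond closed identities in `ZMod 2`/`ℕ`, no certificate, no named fact, no `sorry`.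
`Interfaces.lean` (C1), every E term, B01, `Transposition/*`, `PortJoin/*`, `D2Bridge/*` untouched.
HONEST FRAMING: `HC_CM` is NOT proved, here or anywhere in the tree; nothing here is a period, a count of record or a headline.
T5: n/a-class (hypothesis binders = the datum equations / the slot data only); checker: self, 2026-08-24.
-/
import Summits.HodgeConjecture.CorCM.Census.OcticProductCosets
import Summits.HodgeConjecture.CorCM.Census.TypeStabiliserCharK
import Summits.HodgeConjecture.CorCM.Census.CoinvariantFloor

/-!
# The octic product column: the type-stabiliser subgroup, `d₂`, `β` against `φ₂`, and THE FLOOR (`Q₈ × B`, `D₄ × B`)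

COR-CM (cell `pub-hodgecm2`, stage 2 of the Hodge ladder), count-neutral KERNEL COMBINATORICS by the binder seat b23 (gen 45; lane OCTIC-PRODUCT, HOME/INBOX.md l.18829 — the port of gen 44ʼs quartic inversion lane `Census/QuarticInversion*` to the datum with `y` CENTRAL on `ι(H₀)`).  Theorems only, on top of the dictionary of the lane (`Census/QuarticInversion{Dictionary,Cosets}.lean`),
the census seat lit-andre-3's type-stabiliser subgroup and closed form (`Census/TypeStabiliserSubgroup.lean`, `…IndexTwoRank.lean`, `…CharK.lean`:
`φ₂ + 2 = β + d₂(G/𝒦)` when `|G|/2` is even) and seat b09's coinvariant floor (`Census/CoinvariantFloor.lean`: `φ₂ ≤ |S|`), all BY NAME; no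
`decide` beyond closed identities in `ZMod 2`/`ℕ`, no certificate, no named fact, no `sorry`.  `Interfaces.lean` (C1), every E term, B01, `Transposition/*`,
`PortJoin/*` untouched.
HONEST FRAMING: `HC_CM` is NOT proved, here or anywhere in the tree; nothing here is a period, a count of record or a headline.

THE TWO COLUMNS (along an octic product datum `D : Datum G c B ζ`; `𝒦(G,c) = ⟨c, {g | c ∉ ⟨g⟩}⟩`, `β = #Block c`, `φ₂` = the coinvariant fibre).
* §1 squares and powers in the three outer cosets: `(y ι a)² = (t y ι a)² = ι(ζ, 0)·ι(2a)`, `(t ι a)² = c·ι(2a)`, hence `g^{2k} = ι(e)^k ι(2k·a)`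
  and `c ∈ ⟨g⟩` whenever `g² = c·ι(2a)` with `4 ∤ ord a.2` (`c_mem_zpowers_of_sq`), `c ∉ ⟨g⟩` whenever `g² = ι(2a)`, `g ∉ ι(H₀)`.
* §2 **ζ = 0 — `D₄ × B`, EVERY `B`**: `c ∉ ⟨y ι a⟩`, `c ∉ ⟨t y ι a⟩` for every `a`, so **`𝒦 = G`** (`mem_stabGen_of_zero`),
  `d₂(G/𝒦) = 0` and **`β = φ₂ + 2`** (`card_block_eq_fibreTwo_add_two_of_zero`; `D₄` with `c = r²`: `4 = 2 + 2`).
* §3 **ζ = 1 — `Q₈ × B`, `B` WITHOUT ELEMENTS OF ORDER `4`**: `c = (g)^{2k}` for every `g = y ι(e,s), t ι(e,s), t y ι(e,s)` with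
  `k ∈ {ord s, ord s / 2}` odd (here `4 ∤ ord s` is used), so no element outside `ι(H₀)` generates `𝒦`, and **`ι(H₀) = 𝒦`**
  (`ιRange_eq_stabGen_of_one`), of index four with the three over-groups `subY, subT, subTY` of `…Cosets`: **`d₂(G/𝒦) = 2`**, and
  **`β = φ₂`** (`card_block_eq_fibreTwo_of_one`; `Q₈`: `2 = 2`; `Q₈ × ℤ/3`: `172`, lit-andre-3's `Census/TwentyFourC3Q8Minimality.lean`).  (With an element of order `4` in `B` all three outer
  cosets meet `𝒦`, `𝒦 = G` and `φ₂ = β − 2` — not treated here.)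
* §4 (every `(G, c)` with `c` central) b09ʼs FLOOR `φ₂ ≤ |S|` in the `lowerBounds` packaging the law files consume (`fibreTwo_mem_lowerBounds`):
  the laws of this column read **`μ = φ₂`** for both `ζ`.  All [folklore] (Pohlmann [Pohlmann1968, Thm 1]).

## References
* [Pohlmann1968] H. Pohlmann, Algebraic cycles on abelian varieties of complex multiplication type, Ann. of Math. 88 (1968), Thm 1.
* [Milne1999] J. S. Milne, Lefschetz motives and the Tate conjecture, Compositio Math. 117 (1999), Prop. 2.1, p. 54.
-/

namespace Summit.HodgeConjecture.CorCM.Census.OcticProduct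

open Finset
open Summit.HodgeConjecture.CorCM.Prior.AllgGroup.RfwfAllgGroup
open Summit.HodgeConjecture.CorCM.Census.BlockParity
open Summit.HodgeConjecture.CorCM.Census.Coinvariant
open Summit.HodgeConjecture.CorCM.Census.TypeStabiliser
open Summit.HodgeConjecture.CorCM.Census.IndexTwo

open Summit.HodgeConjecture.CorCM.Census.QuarticInversion (half)

noncomputable section

section Powers

variable {G : Type*} [Group G] {c : G} {A : Type} [AddCommGroup A] {ζ : ZMod 2} (D : Datum G c A ζ)

/-! ## §1 Squares and powers in the outer cosets -/

/-- `ι (n • a) = ι a ^ n`. [folklore] -/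
theorem ι_pow (a : ZMod 2 × A) (n : ℕ) : D.ι (n • a) = D.ι a ^ n := by
  show ιHom D (Multiplicative.ofAdd (n • a)) = ιHom D (Multiplicative.ofAdd a) ^ n
  rw [ofAdd_nsmul, map_pow]

/-- `ι (k • a) = ι a ^ k` for `k : ℤ`. [folklore] -/
theorem ι_zpow (a : ZMod 2 × A) (k : ℤ) : D.ι (k • a) = D.ι a ^ k := by
  show ιHom D (Multiplicative.ofAdd (k • a)) = ιHom D (Multiplicative.ofAdd a) ^ k
  rw [ofAdd_zsmul, map_zpow]

/-- **`ι(ζ, 0)·ι(2a) = (y ι a)²`** (`y` central on `ι(H₀)`). [folklore] -/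
theorem yι_sq (a : ZMod 2 × A) : D.ι (ζ, 0) * D.ι (a + a) = D.y * D.ι a * (D.y * D.ι a) := by
  symm
  rw [← mul_assoc, mul_assoc D.y, ι_mul_y, ← mul_assoc, D.y_mul_y, mul_assoc, ← D.map_add]

/-- **`ι(ζ, 0)·ι(2a) = (t y ι a)²`.** [folklore] -/
theorem tyι_sq (a : ZMod 2 × A) : D.ι (ζ, 0) * D.ι (a + a) = D.t * (D.y * D.ι a) * (D.t * (D.y * D.ι a)) := by
  symm
  rw [mul_assoc, mul_assoc, ← mul_assoc (D.ι a), ι_mul_t, mul_assoc, ← mul_assoc D.y (D.t), ← mul_assoc D.t, ← mul_assoc D.t,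
    t_mul_y_mul_t, ← mul_assoc, ← yι_sq]

/-- `(t ι a)² = c · ι(2a)`. [folklore] -/
private theorem tι_sq (a : ZMod 2 × A) : D.t * D.ι a * (D.t * D.ι a) = c * D.ι (a + a) := by
  rw [mul_assoc, ← mul_assoc (D.ι a), ι_mul_t, mul_assoc, ← D.map_add, ← mul_assoc, D.t_mul_t]

include D in
/-- `c^k = c` for odd `k`, `= 1` for even `k`. [folklore] -/
private theorem c_pow_eq (k : ℕ) : c ^ k = if Even k then 1 else c := by
  induction k with
  | zero => simp
  | succ n ih =>
    rw [pow_succ, ih]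
    by_cases hn : Even n
    · rw [if_pos hn, if_neg (Nat.not_even_iff_odd.mpr hn.add_one), one_mul]
    · rw [if_neg hn, if_pos (Nat.odd_iff.mpr ?_ |>.add_one), c_mul_c D]
      exact Nat.not_even_iff.mp hn

/-- **`g^{2k} = ι(e)^k · ι((2k) • a)` whenever `g² = ι e · ι(2a)`.** [folklore] -/
private theorem pow_two_mul_of_sq {g : G} {e a : ZMod 2 × A} (hg : g * g = D.ι e * D.ι (a + a)) (k : ℕ) :
    g ^ (2 * k) = D.ι e ^ k * D.ι ((2 * k) • a) := by
  induction k with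
  | zero => simp [ι_zero D]
  | succ n ih =>
    rw [Nat.mul_succ, pow_add, ih, pow_two, hg, pow_succ, add_nsmul, two_nsmul, mul_assoc (D.ι e ^ n),
      ← mul_assoc (D.ι _) (D.ι e), ι_comm D _ e, mul_assoc (D.ι e), ← mul_assoc (D.ι e ^ n), D.map_add ((2 * n) • a) (a + a)]

/-- **`c ∈ ⟨g⟩` whenever `g² = c · ι(2·(e,s))` and `4 ∤ ord s`**: `g^{2k} = c^k ι(0, 2k·s)` with `k = ord s` (odd) or `k = ord s / 2` (odd). [folklore] -/
theorem c_mem_zpowers_of_sq {g : G} (a : ZMod 2 × A) (hg : g * g = c * D.ι (a + a)) (h4 : ¬ 4 ∣ addOrderOf a.2) :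
    c ∈ Subgroup.zpowers g := by
  have hpow : ∀ k : ℕ, g ^ (2 * k) = c ^ k * D.ι ((2 * k) • a) := fun k => by
    have h := pow_two_mul_of_sq D (g := g) (e := (1, 0)) (a := a) (by rw [D.map_c]; exact hg) k
    rwa [D.map_c] at h
  obtain ⟨e, s⟩ := a
  dsimp only at h4
  have h2e : ∀ k : ℕ, (2 * k) • e = 0 := fun k => by
    have h2 : ((2 : ℕ) : ZMod 2) = 0 := by decide
    rw [nsmul_eq_mul, Nat.cast_mul, h2, zero_mul, zero_mul]
  obtain ⟨j, hj⟩ | ⟨j, hj⟩ := Nat.even_or_odd (addOrderOf s)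
  · have hjodd : Odd j := by
      rcases Nat.even_or_odd j with ⟨i, hi⟩ | hodd
      · exact absurd ⟨i, by rw [hj, hi]; ring⟩ h4
      · exact hodd
    refine Subgroup.mem_zpowers_iff.mpr ⟨(2 * j : ℕ), ?_⟩
    rw [zpow_natCast, hpow, c_pow_eq D, if_neg (Nat.not_even_iff_odd.mpr hjodd)]
    have hs : (2 * j) • s = 0 := by rw [two_mul, ← hj]; exact addOrderOf_nsmul_eq_zero s
    rw [Prod.smul_mk, h2e, hs, show ((0 : ZMod 2), (0 : A)) = 0 from rfl, ι_zero, mul_one]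
  · refine Subgroup.mem_zpowers_iff.mpr ⟨(2 * addOrderOf s : ℕ), ?_⟩
    rw [zpow_natCast, hpow, c_pow_eq D, if_neg (Nat.not_even_iff_odd.mpr ⟨j, hj⟩)]
    have hs : (2 * addOrderOf s) • s = 0 := by rw [mul_comm, mul_nsmul, addOrderOf_nsmul_eq_zero, nsmul_zero]
    rw [Prod.smul_mk, h2e, hs, show ((0 : ZMod 2), (0 : A)) = 0 from rfl, ι_zero, mul_one]

/-- **`c ∈ ⟨t ι a⟩` for every `a`, when `B` has no element of order `4`.** [folklore] -/
theorem c_mem_zpowers_tι (hB : ∀ s : A, ¬ 4 ∣ addOrderOf s) (a : ZMod 2 × A) : c ∈ Subgroup.zpowers (D.t * D.ι a) :=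
  c_mem_zpowers_of_sq D a (tι_sq D a) (hB a.2)

/-- **`c ∉ ⟨g⟩` whenever `g² = ι(2a)` and `g ∉ ι(H₀)`**: even powers of `g` are `ι(m·2a)`, of first coordinate `0 ≠ 1`, odd powers lie outside `ι(H₀)`. [folklore] -/
theorem c_notMem_zpowers_of_sq {g : G} (a : ZMod 2 × A) (hg : g * g = D.ι (a + a)) (hgι : ∀ b, g ≠ D.ι b) :
    c ∉ Subgroup.zpowers g := by
  intro h
  obtain ⟨k, hk⟩ := Subgroup.mem_zpowers_iff.mp h
  have hsq : g ^ (2 : ℤ) = D.ι (a + a) := by rw [zpow_two, hg]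
  have h11 : ∀ u : ZMod 2, u + u = 0 := by decide
  obtain ⟨m, rfl | rfl⟩ := Int.even_or_odd' k
  · rw [zpow_mul, hsq, ← ι_zpow] at hk
    have h1 := congrArg Prod.fst (D.inj (hk.trans D.map_c.symm))
    simp only [Prod.smul_fst, Prod.fst_add, h11, smul_zero] at h1
    exact zero_ne_one h1
  · rw [zpow_add, zpow_one, zpow_mul, hsq, ← ι_zpow] at hk
    exact hgι (-(m • (a + a)) + (1, 0)) (by rw [D.map_add, D.map_c, ι_neg]; exact eq_inv_mul_of_mul_eq hk)

/-- `ι(e, s) ∈ 𝒦` for every `(e, s)` (`ι(e,s) = ι(e,0)·ι(0,s)`, `ι(1,0) = c`; `c ∉ ⟨ι(0,s)⟩` since every power of `ι(0,s)` has first coordinate `0`). [folklore] -/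
private theorem ι_mem_stabGen (a : ZMod 2 × A) : D.ι a ∈ stabGen c := by
  obtain ⟨e, s⟩ := a
  have hsplit : D.ι (e, s) = D.ι (e, 0) * D.ι (0, s) := by
    rw [← D.map_add, Prod.mk_add_mk, add_zero, zero_add]
  rw [hsplit]
  have hnot : c ∉ Subgroup.zpowers (D.ι (0, s)) := by
    intro h
    obtain ⟨k, hk⟩ := Subgroup.mem_zpowers_iff.mp h
    rw [← ι_zpow] at hk
    have h1 : (k • (((0 : ZMod 2), s) : ZMod 2 × A)).1 = (((1 : ZMod 2), (0 : A)) : ZMod 2 × A).1 :=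
      congrArg Prod.fst (D.inj (hk.trans D.map_c.symm))
    simp only [Prod.smul_fst, smul_zero] at h1
    exact zero_ne_one h1
  refine Subgroup.mul_mem _ ?_ (mem_stabGen_of_notMem_zpowers c hnot)
  have h01 : ∀ u : ZMod 2, u = 0 ∨ u = 1 := by decide
  rcases h01 e with rfl | rfl
  · rw [show ((0 : ZMod 2), (0 : A)) = (0 : ZMod 2 × A) from rfl, ι_zero]
    exact Subgroup.one_mem _
  · rw [D.map_c]
    exact self_mem_stabGen c

end Powers

section Zero

variable {G : Type*} [Group G] [Fintype G] [DecidableEq G] {c : G}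
variable {A : Type} [AddCommGroup A] [Fintype A] [DecidableEq A] (D : Datum G c A 0)

/-! ## §2 `ζ = 0`: the column `D₄ × B` — `𝒦 = G`, `φ₂ = β − 2`, floor `β ≤ |S| + 2` -/

omit [Fintype G] [DecidableEq G] [Fintype A] [DecidableEq A] in
/-- For `ζ = 0`: `y² = 1`. [folklore] -/
private theorem y_mul_y_of_zero : D.y * D.y = 1 := by
  rw [D.y_mul_y]; exact ι_zero D

omit [Fintype G] [DecidableEq G] [Fintype A] [DecidableEq A] in
/-- For `ζ = 0`, every `y ι a` lies in `𝒦` (`c ∉ ⟨y ι a⟩`). [folklore] -/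
private theorem yι_mem_stabGen_of_zero (a : ZMod 2 × A) : D.y * D.ι a ∈ stabGen c :=
  mem_stabGen_of_notMem_zpowers c (c_notMem_zpowers_of_sq D a
    (by rw [← yι_sq, show ((0 : ZMod 2), (0 : A)) = 0 from rfl, ι_zero, one_mul]) fun b => (ι_ne_yι D b a).symm)

omit [Fintype G] [DecidableEq G] [Fintype A] [DecidableEq A] in
/-- For `ζ = 0`, every `t y ι a` lies in `𝒦` (`c ∉ ⟨t y ι a⟩`). [folklore] -/
private theorem tyι_mem_stabGen_of_zero (a : ZMod 2 × A) : D.t * (D.y * D.ι a) ∈ stabGen c :=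
  mem_stabGen_of_notMem_zpowers c (c_notMem_zpowers_of_sq D a
    (by rw [← tyι_sq, show ((0 : ZMod 2), (0 : A)) = 0 from rfl, ι_zero, one_mul]) fun b => (ι_ne_tyι D b a).symm)

omit [Fintype G] [DecidableEq G] [Fintype A] [DecidableEq A] in
include D in
/-- **`ζ = 0`: every element of `G` lies in `𝒦(G, c)`.** [folklore] -/
theorem mem_stabGen_of_zero (g : G) : g ∈ stabGen c := by
  have hι : ∀ a, D.ι a = D.y * D.ι 0 * (D.y * D.ι a) := fun a => by
    rw [ι_zero, mul_one, ← mul_assoc, y_mul_y_of_zero D, one_mul]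
  obtain ⟨a, rfl | rfl | rfl | rfl⟩ := D.exhaust g
  · rw [hι a]; exact (stabGen c).mul_mem (yι_mem_stabGen_of_zero D 0) (yι_mem_stabGen_of_zero D a)
  · exact yι_mem_stabGen_of_zero D a
  · have h : D.t * D.ι a = D.t * (D.y * D.ι 0) * (D.y * D.ι a) := by
      rw [mul_assoc D.t, ← hι]
    rw [h]; exact (stabGen c).mul_mem (tyι_mem_stabGen_of_zero D 0) (yι_mem_stabGen_of_zero D a)
  · exact tyι_mem_stabGen_of_zero D a

omit [Fintype G] [DecidableEq G] [Fintype A] [DecidableEq A] in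
include D in
/-- `ζ = 0`: `d₂(G/𝒦) = 0`. [folklore] -/
private theorem indexTwoRank_stabGen_eq_zero_of_zero : indexTwoRank (stabGen c) = 0 := by
  rw [show stabGen c = ⊤ from top_unique fun g _ => mem_stabGen_of_zero D g]; exact indexTwoRank_top

omit [DecidableEq A] in
include D in
/-- **`ζ = 0`: `β(G, c) = φ₂(G, c) + 2`** — the block count of the column `D₄ × B` sits two above the coinvariant fibre. [folklore] -/
theorem card_block_eq_fibreTwo_add_two_of_zero (hc2 : c * c = 1) :
    Fintype.card (BlockParity.Block c) = fibreTwo c hc2 + 2 := by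
  have h := fibreTwo_add_two_eq_card_block_add_indexTwoRank c hc2 (c_ne_one D) (mul_c_comm D)
    ⟨2 * Fintype.card A, by rw [← card_group_eq_eight_mul D]; omega⟩
  rw [indexTwoRank_stabGen_eq_zero_of_zero D, add_zero] at h
  exact h.symm

end Zero

section One

variable {G : Type*} [Group G] [Fintype G] [DecidableEq G] {c : G}
variable {A : Type} [AddCommGroup A] [Fintype A] [DecidableEq A] (D : Datum G c A 1)

/-! ## §3 `ζ = 1`, no element of order `4` in `B`: the column `Q₈ × B` — `𝒦 = ι(H₀)`, `d₂ = 2`, `φ₂ = β`, floor `β ≤ |S|` -/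

omit [Fintype G] [DecidableEq G] [Fintype A] [DecidableEq A] in
/-- For `ζ = 1`: `c ∈ ⟨y ι a⟩` for every `a`, when `B` has no element of order `4`. [folklore] -/
theorem c_mem_zpowers_yι_of_one (hB : ∀ s : A, ¬ 4 ∣ addOrderOf s) (a : ZMod 2 × A) : c ∈ Subgroup.zpowers (D.y * D.ι a) :=
  c_mem_zpowers_of_sq D a (by rw [← yι_sq, D.map_c]) (hB a.2)

omit [Fintype G] [DecidableEq G] [Fintype A] [DecidableEq A] in
/-- For `ζ = 1`: `c ∈ ⟨t y ι a⟩` for every `a`, when `B` has no element of order `4`. [folklore] -/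
theorem c_mem_zpowers_tyι_of_one (hB : ∀ s : A, ¬ 4 ∣ addOrderOf s) (a : ZMod 2 × A) : c ∈ Subgroup.zpowers (D.t * (D.y * D.ι a)) :=
  c_mem_zpowers_of_sq D a (by rw [← tyι_sq, D.map_c]) (hB a.2)

omit [Fintype G] [DecidableEq G] [Fintype A] [DecidableEq A] in
/-- **`ζ = 1`, no element of order `4`: `ι(ℤ/2 × B) = 𝒦(G, c)`.** [folklore] -/
theorem ιRange_eq_stabGen_of_one (hB : ∀ s : A, ¬ 4 ∣ addOrderOf s) : (ιHom D).range = stabGen c := by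
  refine le_antisymm ?_ ?_
  swap
  · have hc : c ∈ (ιHom D).range := by have h := ι_mem_ιRange D (1, 0); rwa [D.map_c] at h
    refine (stabGen_le_iff_subset c).mpr ⟨hc, fun g hg => ?_⟩
    obtain ⟨a, rfl | rfl | rfl | rfl⟩ := D.exhaust g
    · exact ι_mem_ιRange D a
    · exact absurd (c_mem_zpowers_yι_of_one D hB a) hg
    · exact absurd (c_mem_zpowers_tι D hB a) hg
    · exact absurd (c_mem_zpowers_tyι_of_one D hB a) hg
  · rintro g hg
    obtain ⟨a, rfl⟩ := MonoidHom.mem_range.mp hg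
    exact ι_mem_stabGen D a.toAdd

omit [Fintype G] [DecidableEq G] [Fintype A] [DecidableEq A] in
include D in
/-- `ζ = 1`, no element of order `4`: exactly three subgroups of index two lie over `𝒦`. [folklore] -/
private theorem card_indexTwoOver_stabGen_of_one (hB : ∀ s : A, ¬ 4 ∣ addOrderOf s) :
    Nat.card {H : Subgroup G // H.index = 2 ∧ stabGen c ≤ H} = 3 := by
  rw [← ιRange_eq_stabGen_of_one D hB]
  let f : Fin 3 → {H : Subgroup G // H.index = 2 ∧ (ιHom D).range ≤ H} :=
    ![⟨subY D, index_subY D, (ιRange_le_sub D).1⟩, ⟨subT D, index_subT D, (ιRange_le_sub D).2.1⟩,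
      ⟨subTY D, index_subTY D, (ιRange_le_sub D).2.2⟩]
  have hf : Function.Bijective f := by
    refine ⟨fun i j h => ?_, fun H => ?_⟩
    · have h' := congrArg Subtype.val h
      fin_cases i <;> fin_cases j <;>
        simp only [f, Fin.zero_eta, Fin.mk_one, Fin.reduceFinMk, Matrix.cons_val_zero, Matrix.cons_val_one, Matrix.cons_val] at h' ⊢
      · exact absurd h' (sub_ne D).1
      · exact absurd h' (sub_ne D).2.1
      · exact absurd h'.symm (sub_ne D).1
      · exact absurd h' (sub_ne D).2.2
      · exact absurd h'.symm (sub_ne D).2.1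
      · exact absurd h'.symm (sub_ne D).2.2
    · rcases eq_sub_of_index_two D H.2.1 H.2.2 with h | h | h
      · exact ⟨0, Subtype.ext h.symm⟩
      · exact ⟨1, Subtype.ext h.symm⟩
      · exact ⟨2, Subtype.ext h.symm⟩
  rw [← Nat.card_eq_of_bijective f hf, Nat.card_eq_fintype_card, Fintype.card_fin]

omit [DecidableEq G] [Fintype A] [DecidableEq A] in
include D in
/-- `ζ = 1`, no element of order `4`: `d₂(G/𝒦) = 2`. [folklore] -/
private theorem indexTwoRank_stabGen_eq_two_of_one (hB : ∀ s : A, ¬ 4 ∣ addOrderOf s) : indexTwoRank (stabGen c) = 2 := by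
  have h := two_pow_indexTwoRank_stabGen c (mul_c_comm D)
  rw [card_indexTwoOver_stabGen_of_one D hB] at h
  exact Nat.pow_right_injective (le_refl 2) (by simpa using h)

omit [DecidableEq A] in
include D in
/-- **`ζ = 1`, no element of order `4`: `β(G, c) = φ₂(G, c)`** — the block count of the column `Q₈ × B` IS the coinvariant fibre. [folklore] -/
theorem card_block_eq_fibreTwo_of_one (hB : ∀ s : A, ¬ 4 ∣ addOrderOf s) (hc2 : c * c = 1) :
    Fintype.card (BlockParity.Block c) = fibreTwo c hc2 := by
  have h := fibreTwo_add_two_eq_card_block_add_indexTwoRank c hc2 (c_ne_one D) (mul_c_comm D)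
    ⟨2 * Fintype.card A, by rw [← card_group_eq_eight_mul D]; omega⟩
  rw [indexTwoRank_stabGen_eq_two_of_one D hB] at h
  omega

end One

section Floor

variable {G : Type*} [Group G] [Fintype G] [DecidableEq G] {c : G}

/-! ## §4 The coinvariant floor as a lower bound of the face-count set (every `(G, c)` with `c` central) -/

/-- **b09ʼs floor in `lowerBounds` form**: for `c` central, `φ₂(G, c)` is a lower bound of the set of cardinalities of `G`-face families
generating the Hodge span modulo pairs. [folklore] -/
theorem fibreTwo_mem_lowerBounds (hc2 : c * c = 1) (hcen : ∀ g : G, g * c = c * g) :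
    fibreTwo c hc2 ∈ lowerBounds {m : ℕ | ∃ S : Finset (CMF G c →₀ ℤ), ↑S ⊆ gfaceSet G c hc2 ∧ S.card = m ∧
      hodgeSpan c hc2 ≤ Submodule.span ℤ (pairSet c) ⊔ Submodule.span ℤ (translates c S)} := by
  rintro m ⟨S, hSF, rfl, hgen⟩
  exact fibreTwo_le_card c hc2 hcen S (Submodule.span ℤ (pairSet c)) le_rfl
    (fun _ hy => gfaceSet_subset_hodgeSpan c hc2 (hSF hy)) (fun _ hy => hgen (gfaceSet_subset_hodgeSpan c hc2 hy))

end Floor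

end

end Summit.HodgeConjecture.CorCM.Census.OcticProduct
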